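import Summits.AtomisticToContinuum.HydrodynamicLimit.Theorems.CollisionIsometryCLTAdaptedWeightCLTBHDVTransfer

/-!
# Aggregate DV step (stub `stub_dvAggregate`, G2) for the line `block-h-dissipation-closure`
# (crux `AdaptedWeightCLT`, stmt-AtomisticToContinuum-14868), file 3: the chaos reference, uniformly in the location

Support file (`--supports stmt-AtomisticToContinuum-14868`, anchor `bhDVAggregate_logChaos_anchor`) of the line
lead `prover-line-stmt-AtomisticToContinuum-14868-c4-0`, written for the registered stub `stub_dvAggregate`.
The S2 worker's log-envelope of the chaos reference (`DVTransfer.abs_log_chaosDens_le`) bounds `|log chaosDens_x|`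
by a constant depending on the location `x` through the normalised weight `K = cw_l cw_l′ ∫B / pairZ` of SOME
flux-positive pair, which degenerates as `x` leaves the kernel supports. Choosing instead the pair of MAXIMAL flux
weight (`exists_maxPair`: `K ≥ (N+1)^{-2}`) gives an envelope uniform in `x`:

* `abs_log_chaosDens_le_unif` — off the junk case, for a configuration with speeds `≤ V`,
  `|log chaosDens_x(y)| ≤ 2 log(N+1) + 8 |log G_h(0)| + 6V²/h² + Σ_m ‖y_m‖²/h²`;
* `pairSmear2_le`, `coeff_mul_pairSmear2_le` — the two-fold smeared pair term `S_{ll′}` is `≤ G_h(0)² ∫B_{ll′}`, and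
  the normalised coefficient of the factorised chaos reference satisfies
  `pairZ⁻¹ cw_l cw_l′ · S_{ll′} ≤ (∫B_{ll′})⁻¹ · S_{ll′}` at every location (both sides vanish for a flux-less pair) —
  the `x`-free majorant of the tilted chaos reference used by file 4.

No definitions.
-/

namespace Summit.AtomisticToContinuum.HydrodynamicLimit.Theorems.BlockHDissipation

open scoped BigOperators Topology Classical MeasureTheory ENNReal InnerProductSpace
open Filter Set MeasureTheory Real
open Literature.Analysis.FluidPDE
open Summit.AtomisticToContinuum.HydrodynamicLimit.Theorems.ContactSourceDuhamel (T3 V3 Cfg Vel Flow Flows)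
open Literature.MathematicalPhysics.KineticTheory (hsDiameter collide hardSphereKernel sphereMeasure)

noncomputable section

namespace DVAggregate

variable {N : ℕ} {ψ : ℕ → T3 → ℝ}

/-! ## The pair of maximal flux weight -/

/-- A single flux weight is at most the pair flux: `cw_l cw_l′ ∫ B((v_l, v_l′), ω) dω ≤ pairZ`. -/
theorem fluxWeight_le_pairZ (hψ : ∀ N y, 0 ≤ ψ N y) (w : Cfg N) (x : T3) (l l' : Fin (N + 1)) :
    cw N ψ w x l * cw N ψ w x l' * ∫ ω, hardSphereKernel ((w l).2, (w l').2) ω ∂sphereMeasure ≤ pairZ N ψ w x := by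
  have hnn : ∀ a b : Fin (N + 1), 0 ≤ cw N ψ w x a * cw N ψ w x b *
      ∫ ω, hardSphereKernel ((w a).2, (w b).2) ω ∂sphereMeasure := fun a b =>
    mul_nonneg (mul_nonneg (DVTransfer.cw_nonneg hψ N w x a) (DVTransfer.cw_nonneg hψ N w x b))
      (DVTransfer.integral_hardSphereKernel_sphere_nonneg _)
  unfold pairZ
  refine le_trans ?_ (Finset.single_le_sum (f := fun a => ∑ b, cw N ψ w x a * cw N ψ w x b *
      ∫ ω, hardSphereKernel ((w a).2, (w b).2) ω ∂sphereMeasure) (fun a _ => Finset.sum_nonneg fun b _ => hnn a b)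
    (Finset.mem_univ l))
  exact Finset.single_le_sum (f := fun b => cw N ψ w x l * cw N ψ w x b *
      ∫ ω, hardSphereKernel ((w l).2, (w b).2) ω ∂sphereMeasure) (fun b _ => hnn l b) (Finset.mem_univ l')

/-- **The pair of maximal flux weight.** Off the junk case a pair `(l, l′)` maximising
`cw_l cw_l′ ∫ B((v_l, v_l′), ω) dω` has positive weight and carries at least the average: `pairZ ≤ (N+1)² ·` it. -/
theorem exists_maxPair (w : Cfg N) (x : T3) (hZ : 0 < pairZ N ψ w x) :
    ∃ l l' : Fin (N + 1), 0 < cw N ψ w x l * cw N ψ w x l' * ∫ ω, hardSphereKernel ((w l).2, (w l').2) ω ∂sphereMeasure ∧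
      pairZ N ψ w x ≤ ((N + 1 : ℕ) : ℝ) ^ 2 *
        (cw N ψ w x l * cw N ψ w x l' * ∫ ω, hardSphereKernel ((w l).2, (w l').2) ω ∂sphereMeasure) := by
  obtain ⟨T, hT⟩ : ∃ T : Fin (N + 1) × Fin (N + 1) → ℝ, ∀ q, T q =
      cw N ψ w x q.1 * cw N ψ w x q.2 * ∫ ω, hardSphereKernel ((w q.1).2, (w q.2).2) ω ∂sphereMeasure :=
    ⟨_, fun _ => rfl⟩
  obtain ⟨q, -, hq⟩ := Finset.exists_max_image (Finset.univ : Finset (Fin (N + 1) × Fin (N + 1))) T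
    ⟨((0 : Fin (N + 1)), (0 : Fin (N + 1))), Finset.mem_univ _⟩
  have hsum : pairZ N ψ w x ≤ ((N + 1 : ℕ) : ℝ) ^ 2 * T q := by
    unfold pairZ
    calc ∑ l, ∑ l', cw N ψ w x l * cw N ψ w x l' * ∫ ω, hardSphereKernel ((w l).2, (w l').2) ω ∂sphereMeasure
        = ∑ l, ∑ l', T (l, l') := by simp only [hT]
      _ ≤ ∑ _l : Fin (N + 1), ∑ _l' : Fin (N + 1), T q :=
          Finset.sum_le_sum fun l _ => Finset.sum_le_sum fun l' _ => hq (l, l') (Finset.mem_univ _)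
      _ = ((N + 1 : ℕ) : ℝ) ^ 2 * T q := by
          simp only [Finset.sum_const, Finset.card_univ, Fintype.card_fin, nsmul_eq_mul]
          push_cast
          ring
  refine ⟨q.1, q.2, ?_, ?_⟩
  · rw [← hT]
    by_contra hcon
    have : pairZ N ψ w x ≤ 0 := hsum.trans (mul_nonpos_of_nonneg_of_nonpos (by positivity) (not_lt.1 hcon))
    exact absurd hZ (not_lt.2 this)
  · rw [← hT]; exact hsum

/-! ## The uniform log-envelope of the chaos reference -/

/-- **Uniform log-envelope of the chaos reference.** For a nonnegative kernel family, `h ≠ 0`, a configuration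
with speeds `≤ V` and a location off the junk case,
`|log chaosDens_x(y)| ≤ 2 log(N+1) + 8 |log G_h(0)| + 6V²/h² + Σ_m ‖y_m‖²/h²` — a constant independent of `x`
plus a quadratic weight in `y`. -/
theorem abs_log_chaosDens_le_unif (hψ : ∀ N y, 0 ≤ ψ N y) {h : ℝ} (hh : h ≠ 0) (w : Cfg N) {V : ℝ}
    (hV : ∀ i, ‖(w i).2‖ ≤ V) (x : T3) (hZ : 0 < pairZ N ψ w x) (y : Quad) :
    |Real.log (chaosDens N ψ h w x y)| ≤ 2 * Real.log ((N + 1 : ℕ) : ℝ) + 8 * |Real.log (gauss h (0 : V3) 0)| +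
      6 * V ^ 2 / h ^ 2 + (‖y.1‖ ^ 2 + ‖y.2.1‖ ^ 2 + ‖y.2.2.1‖ ^ 2 + ‖y.2.2.2‖ ^ 2) / h ^ 2 := by
  have hh2 : 0 < h ^ 2 := pow_pos (abs_pos.2 hh) 2 |>.trans_eq (sq_abs h)
  obtain ⟨l, l', hll, hmax⟩ := exists_maxPair w x hZ
  set v₁ : V3 := (w l).2 with hv₁
  set v₂ : V3 := (w l').2 with hv₂
  set R2 : ℝ := ‖v₁‖ ^ 2 + ‖v₂‖ ^ 2 with hR2
  set K : ℝ := (pairZ N ψ w x)⁻¹ * (cw N ψ w x l * cw N ψ w x l') * ∫ ω, hardSphereKernel (v₁, v₂) ω ∂sphereMeasure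
    with hK
  have hKpos : 0 < K := by
    rw [hK, mul_assoc]; exact mul_pos (inv_pos.2 hZ) hll
  -- `(N+1)^{-2} ≤ K ≤ 1`
  have hK1 : K ≤ 1 := by
    rw [hK, mul_assoc, inv_mul_le_iff₀ hZ, mul_one]
    exact fluxWeight_le_pairZ hψ w x l l'
  have h1K : 1 ≤ ((N + 1 : ℕ) : ℝ) ^ 2 * K := by
    have e : ((N + 1 : ℕ) : ℝ) ^ 2 * K = ((N + 1 : ℕ) : ℝ) ^ 2 *
        (cw N ψ w x l * cw N ψ w x l' * ∫ ω, hardSphereKernel (v₁, v₂) ω ∂sphereMeasure) / pairZ N ψ w x := by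
      rw [hK]; field_simp
    rw [e, le_div_iff₀ hZ, one_mul]
    exact hmax
  have hN1 : (1 : ℝ) ≤ ((N + 1 : ℕ) : ℝ) := by exact_mod_cast Nat.succ_le_succ (Nat.zero_le N)
  have hlogK0 : Real.log K ≤ 0 := Real.log_nonpos hKpos.le hK1
  have hlogK : -(2 * Real.log ((N + 1 : ℕ) : ℝ)) ≤ Real.log K := by
    have h0 := Real.log_nonneg h1K
    rw [Real.log_mul (by positivity) hKpos.ne', Real.log_pow, Nat.cast_ofNat] at h0
    linarith
  have habsK : |Real.log K| ≤ 2 * Real.log ((N + 1 : ℕ) : ℝ) := by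
    rw [abs_of_nonpos hlogK0]; linarith
  -- the peak
  set P : ℝ := Real.log ((2 * π * h ^ 2) ^ (-(Module.finrank ℝ V3 : ℝ) / 2)) with hP
  have hG0 : Real.log (gauss h (0 : V3) 0) = P := by rw [DVTransfer.gaussMax_eq]
  rw [hG0]
  -- the floor `a(y)` and the ceiling
  have hlow := DVTransfer.chaosDens_ge hψ hh w x hZ l l' y
  have hup : chaosDens N ψ h w x y ≤ gauss h (0 : V3) 0 ^ 4 := DVTransfer.chaosDens_le hψ h w x hZ.ne' y
  have g1 := DVTransfer.gauss_pos hh v₁ y.1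
  have g2 := DVTransfer.gauss_pos hh v₂ y.2.1
  have g0 : 0 < gauss h (0 : V3) 0 := DVTransfer.gaussMax_pos hh
  have e3 := Real.exp_pos (-((‖y.2.2.1‖ ^ 2 + R2) / h ^ 2))
  have e4 := Real.exp_pos (-((‖y.2.2.2‖ ^ 2 + R2) / h ^ 2))
  have hX3 : 0 < gauss h (0 : V3) 0 * Real.exp (-((‖y.2.2.1‖ ^ 2 + R2) / h ^ 2)) := mul_pos g0 e3
  have hX4 : 0 < gauss h (0 : V3) 0 * Real.exp (-((‖y.2.2.2‖ ^ 2 + R2) / h ^ 2)) := mul_pos g0 e4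
  have hX34 := mul_pos hX3 hX4
  have hX2 := mul_pos g2 hX34
  have hX1 := mul_pos g1 hX2
  clear_value K
  set a : ℝ := (pairZ N ψ w x)⁻¹ * (cw N ψ w x l * cw N ψ w x l') *
      (gauss h v₁ y.1 * gauss h v₂ y.2.1 *
        (gauss h (0 : V3) 0 * Real.exp (-((‖y.2.2.1‖ ^ 2 + R2) / h ^ 2))) *
        (gauss h (0 : V3) 0 * Real.exp (-((‖y.2.2.2‖ ^ 2 + R2) / h ^ 2))) *
        ∫ ω, hardSphereKernel (v₁, v₂) ω ∂sphereMeasure) with ha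
  clear_value a
  have e : a = K * (gauss h v₁ y.1 * (gauss h v₂ y.2.1 *
      ((gauss h (0 : V3) 0 * Real.exp (-((‖y.2.2.1‖ ^ 2 + R2) / h ^ 2))) *
      (gauss h (0 : V3) 0 * Real.exp (-((‖y.2.2.2‖ ^ 2 + R2) / h ^ 2)))))) := by rw [ha, hK]; ring
  have hapos : 0 < a := by rw [e]; exact mul_pos hKpos hX1
  have hb := DVTransfer.abs_log_le_of_mem hapos hlow hup
  -- `log a` explicitly
  set ι : ℝ := (h ^ 2)⁻¹ with hι
  set n1 : ℝ := ‖y.1 - v₁‖ ^ 2 with hn1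
  set n2 : ℝ := ‖y.2.1 - v₂‖ ^ 2 with hn2
  set n3 : ℝ := ‖y.2.2.1‖ ^ 2 with hn3
  set n4 : ℝ := ‖y.2.2.2‖ ^ 2 with hn4
  have hloga : Real.log a = Real.log K + 4 * P - n1 / (2 * h ^ 2) - n2 / (2 * h ^ 2) -
      (ι * n3 + R2 / h ^ 2) - (ι * n4 + R2 / h ^ 2) := by
    rw [e, Real.log_mul hKpos.ne' hX1.ne', Real.log_mul g1.ne' hX2.ne', Real.log_mul g2.ne' hX34.ne',
      Real.log_mul hX3.ne' hX4.ne', Real.log_mul g0.ne' e3.ne', Real.log_mul g0.ne' e4.ne', Real.log_exp,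
      Real.log_exp, hG0, DVTransfer.log_gauss hh, DVTransfer.log_gauss hh, ← hP, ← hn1, ← hn2, hι]
    field_simp
    ring
  have e2 : |Real.log (gauss h (0 : V3) 0 ^ 4)| = 4 * |P| := by
    rw [Real.log_pow, hG0, abs_mul]; push_cast; rw [abs_of_pos (by norm_num : (0 : ℝ) < 4)]
  rw [e2] at hb
  -- assemble
  have q1 : 0 ≤ n1 := sq_nonneg _
  have q2 : 0 ≤ n2 := sq_nonneg _
  have q3 : 0 ≤ n3 := sq_nonneg _
  have q4 : 0 ≤ n4 := sq_nonneg _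
  have hι0 : 0 ≤ ι := by rw [hι]; positivity
  have hR2nn : 0 ≤ R2 := by positivity
  have hRh : R2 / h ^ 2 = ι * ‖v₁‖ ^ 2 + ι * ‖v₂‖ ^ 2 := by rw [hR2, hι]; ring
  have d1 : n1 / (2 * h ^ 2) ≤ ι * ‖y.1‖ ^ 2 + ι * ‖v₁‖ ^ 2 := by
    have t : n1 ≤ 2 * ‖y.1‖ ^ 2 + 2 * ‖v₁‖ ^ 2 := by
      rw [hn1]
      nlinarith only [norm_sub_le y.1 v₁, norm_nonneg (y.1 - v₁), norm_nonneg y.1, norm_nonneg v₁,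
        sq_nonneg (‖y.1‖ - ‖v₁‖)]
    rw [hι, div_le_iff₀ (by positivity)]
    have e' : ((h ^ 2)⁻¹ * ‖y.1‖ ^ 2 + (h ^ 2)⁻¹ * ‖v₁‖ ^ 2) * (2 * h ^ 2) = 2 * ‖y.1‖ ^ 2 + 2 * ‖v₁‖ ^ 2 := by
      field_simp
    rw [e']; exact t
  have d2 : n2 / (2 * h ^ 2) ≤ ι * ‖y.2.1‖ ^ 2 + ι * ‖v₂‖ ^ 2 := by
    have t : n2 ≤ 2 * ‖y.2.1‖ ^ 2 + 2 * ‖v₂‖ ^ 2 := by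
      rw [hn2]
      nlinarith only [norm_sub_le y.2.1 v₂, norm_nonneg (y.2.1 - v₂), norm_nonneg y.2.1, norm_nonneg v₂,
        sq_nonneg (‖y.2.1‖ - ‖v₂‖)]
    rw [hι, div_le_iff₀ (by positivity)]
    have e' : ((h ^ 2)⁻¹ * ‖y.2.1‖ ^ 2 + (h ^ 2)⁻¹ * ‖v₂‖ ^ 2) * (2 * h ^ 2) = 2 * ‖y.2.1‖ ^ 2 + 2 * ‖v₂‖ ^ 2 := by
      field_simp
    rw [e']; exact t
  have d1' : 0 ≤ n1 / (2 * h ^ 2) := by positivity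
  have d2' : 0 ≤ n2 / (2 * h ^ 2) := by positivity
  have d3' : 0 ≤ ι * n3 := mul_nonneg hι0 q3
  have d4' : 0 ≤ ι * n4 := mul_nonneg hι0 q4
  have hRh0 : 0 ≤ R2 / h ^ 2 := by positivity
  have u1 : ι * ‖v₁‖ ^ 2 ≤ ι * V ^ 2 :=
    mul_le_mul_of_nonneg_left (pow_le_pow_left₀ (norm_nonneg _) (hV l) 2) hι0
  have u2 : ι * ‖v₂‖ ^ 2 ≤ ι * V ^ 2 :=
    mul_le_mul_of_nonneg_left (pow_le_pow_left₀ (norm_nonneg _) (hV l') 2) hι0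
  have habsa : |Real.log a| ≤ |Real.log K| + 4 * |P| + n1 / (2 * h ^ 2) + n2 / (2 * h ^ 2) +
      ι * n3 + ι * n4 + 2 * (R2 / h ^ 2) := by
    rw [hloga, abs_le]
    have hPm := neg_abs_le P
    have hPp := le_abs_self P
    have hKm := neg_abs_le (Real.log K)
    have hKp := le_abs_self (Real.log K)
    constructor <;> linarith only [hPm, hPp, hKm, hKp, d1', d2', d3', d4', hRh0]
  have eg1 : 6 * V ^ 2 / h ^ 2 = 6 * (ι * V ^ 2) := by rw [hι]; ring
  have eg2 : (‖y.1‖ ^ 2 + ‖y.2.1‖ ^ 2 + n3 + n4) / h ^ 2 = ι * ‖y.1‖ ^ 2 + ι * ‖y.2.1‖ ^ 2 + ι * n3 + ι * n4 := by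
    rw [hι]; ring
  rw [eg1, eg2]
  linarith only [hb, habsa, habsK, d1, d2, hRh, hRh0, u1, u2, d3', d4']

/-! ## The `x`-free majorant of the normalised two-fold smeared pair term -/

/-- The two-fold smeared pair term is bounded by `G_h(0)² ∫ B dω`. -/
theorem pairSmear2_le (h : ℝ) (p : V3 × V3) (r : V3 × V3) :
    ∫ ω, hardSphereKernel p ω * (gauss h (collide ω p).1 r.1 * gauss h (collide ω p).2 r.2) ∂sphereMeasure ≤
      gauss h (0 : V3) 0 ^ 2 * ∫ ω, hardSphereKernel p ω ∂sphereMeasure := by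
  rw [← integral_const_mul]
  refine integral_mono_of_nonneg (Eventually.of_forall fun ω => mul_nonneg (le_max_right _ _)
      (mul_nonneg (DVTransfer.gauss_nonneg h _ _) (DVTransfer.gauss_nonneg h _ _)))
    ((DVTransfer.integrable_hardSphereKernel_sphere p).const_mul _) (Eventually.of_forall fun ω => ?_)
  have hB : 0 ≤ hardSphereKernel p ω := le_max_right _ _
  have b1 := DVTransfer.gauss_le_gaussMax h (collide ω p).1 r.1
  have b2 := DVTransfer.gauss_le_gaussMax h (collide ω p).2 r.2
  have n1 := DVTransfer.gauss_nonneg h (collide ω p).1 r.1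
  have n2 := DVTransfer.gauss_nonneg h (collide ω p).2 r.2
  simp only
  calc hardSphereKernel p ω * (gauss h (collide ω p).1 r.1 * gauss h (collide ω p).2 r.2)
      ≤ hardSphereKernel p ω * (gauss h (0 : V3) 0 * gauss h (0 : V3) 0) :=
        mul_le_mul_of_nonneg_left (mul_le_mul b1 b2 n2 (DVTransfer.gauss_nonneg h 0 0)) hB
    _ = gauss h (0 : V3) 0 ^ 2 * hardSphereKernel p ω := by ring

/-- **The normalised coefficient of the factorised chaos reference is `x`-free up to the pair flux**:
`pairZ⁻¹ cw_l cw_l′ · S_{ll′}(r) ≤ (∫B_{ll′})⁻¹ · S_{ll′}(r)` for every location (nonnegative kernel family): for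
a flux-less pair both sides vanish (`S_{ll′} ≤ G_h(0)² ∫B_{ll′} = 0`), otherwise `cw_l cw_l′ ∫B_{ll′} ≤ pairZ`. -/
theorem coeff_mul_pairSmear2_le (hψ : ∀ N y, 0 ≤ ψ N y) (h : ℝ) (w : Cfg N) (x : T3) (l l' : Fin (N + 1))
    (r : V3 × V3) :
    (pairZ N ψ w x)⁻¹ * (cw N ψ w x l * cw N ψ w x l') *
        ∫ ω, hardSphereKernel ((w l).2, (w l').2) ω * (gauss h (collide ω ((w l).2, (w l').2)).1 r.1 *
          gauss h (collide ω ((w l).2, (w l').2)).2 r.2) ∂sphereMeasure ≤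
      (∫ ω, hardSphereKernel ((w l).2, (w l').2) ω ∂sphereMeasure)⁻¹ *
        ∫ ω, hardSphereKernel ((w l).2, (w l').2) ω * (gauss h (collide ω ((w l).2, (w l').2)).1 r.1 *
          gauss h (collide ω ((w l).2, (w l').2)).2 r.2) ∂sphereMeasure := by
  set B : ℝ := ∫ ω, hardSphereKernel ((w l).2, (w l').2) ω ∂sphereMeasure with hB
  set S : ℝ := ∫ ω, hardSphereKernel ((w l).2, (w l').2) ω * (gauss h (collide ω ((w l).2, (w l').2)).1 r.1 *
    gauss h (collide ω ((w l).2, (w l').2)).2 r.2) ∂sphereMeasure with hS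
  have hB0 : 0 ≤ B := DVTransfer.integral_hardSphereKernel_sphere_nonneg _
  have hS0 : 0 ≤ S := DVTransfer.pairSmear2_nonneg h _ r
  have hSle : S ≤ gauss h (0 : V3) 0 ^ 2 * B := pairSmear2_le h _ r
  have hcc : 0 ≤ cw N ψ w x l * cw N ψ w x l' := mul_nonneg (DVTransfer.cw_nonneg hψ N w x l) (DVTransfer.cw_nonneg hψ N w x l')
  have hZ0 : 0 ≤ pairZ N ψ w x := DVTransfer.pairZ_nonneg hψ N w x
  rcases hB0.eq_or_lt with hB00 | hBpos
  · -- flux-less pair: `S = 0`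
    have hS00 : S = 0 := le_antisymm (by rw [← hB00, mul_zero] at hSle; exact hSle) hS0
    rw [hS00, mul_zero, mul_zero]
  rcases hcc.eq_or_lt with hcc0 | hccpos
  · rw [← hcc0, mul_zero, zero_mul]; exact mul_nonneg (inv_nonneg.2 hBpos.le) hS0
  have hZpos : 0 < pairZ N ψ w x := lt_of_lt_of_le (mul_pos hccpos hBpos) (fluxWeight_le_pairZ hψ w x l l')
  refine mul_le_mul_of_nonneg_right ?_ hS0
  rw [inv_mul_le_iff₀ hZpos, le_mul_inv_iff₀ hBpos]
  exact fluxWeight_le_pairZ hψ w x l l'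

end DVAggregate

/-! ## Registered anchor of this support file -/

/-- ANCHOR (registered helper stub `bhDVAggregate_logChaos_anchor` of the crux item): the log-envelope of the chaos
reference, uniform in the location — for a nonnegative kernel family, `h ≠ 0`, a configuration with speeds `≤ V`
and a location with positive pair flux, `|log chaosDens_x(y)| ≤ 2 log(N+1) + 8|log G_h(0)| + 6V²/h² + Σ_m‖y_m‖²/h²`. -/
theorem bhDVAggregate_logChaos_anchor : ∀ (N : ℕ) (ψ : ℕ → T3 → ℝ), (∀ N y, 0 ≤ ψ N y) → ∀ (h : ℝ), h ≠ 0 → ∀ (w : Cfg N) (V : ℝ), (∀ i, ‖(w i).2‖ ≤ V) → ∀ (x : T3), 0 < pairZ N ψ w x → ∀ (y : Quad), |Real.log (chaosDens N ψ h w x y)| ≤ 2 * Real.log ((N + 1 : ℕ) : ℝ) + 8 * |Real.log (gauss h (0 : V3) 0)| + 6 * V ^ 2 / h ^ 2 + (‖y.1‖ ^ 2 + ‖y.2.1‖ ^ 2 + ‖y.2.2.1‖ ^ 2 + ‖y.2.2.2‖ ^ 2) / h ^ 2 :=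
  fun _ _ hψ _ hh w _ hV x hZ y => DVAggregate.abs_log_chaosDens_le_unif hψ hh w hV x hZ y

end

end Summit.AtomisticToContinuum.HydrodynamicLimit.Theorems.BlockHDissipation
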